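import Literature.Analysis.FluidPDE.LeiZhang2011MeanValue
import HarnessLib

/-!
# Lei–Zhang 2011, §2: the mean value inequality (2.6) started at the energy exponent `10/3`

Analysis/FluidPDE **proofs file** (theorems only: no definitions, no named facts, no `sorry`)
on the discharge path of `Literature.Analysis.FluidPDE.LeiZhang2011_regularity_bmoStream`
(Z. Lei, Q. S. Zhang, J. Funct. Anal. 261 (2011) = arXiv:1011.5066, **Theorem 1.4**). The tree's
mean value inequality `LeiZhang2011.meanValue_inequality` (file `LeiZhang2011MeanValue`, for
Theorem 1.2) runs the Moser chain `p_k = 4 (10/9)^k` from `L⁴`; a Leray–Hopf weak solution is only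
in `L^{10/3}_{t,x}`, so for the local bound on `Γ = r v^θ` near a singular time (proof of
Theorem 1.4) the chain is re-run from `p₀ = 10/3` (`p_k = (10/3)(10/9)^k`, powers
`H_m = w^m` with `m = (20/9)(10/9)^k > 2`), with the same one-level estimate
`reverse_holder_between_cylinders` and constants `moser_level_constant_le`:

* `eLpNorm_top_cylinder_le_of_reverse_holder_tenThirds` — the chain bookkeeping,
  `‖u‖_{L^∞(Q(ρ/2))} ≤ C₀³ b^{27} ‖u‖_{L^{10/3}(Q(ρ))}` (abstract `eLpNorm_top_le_of_moser_chain`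
  with `p₀ = 10/3`, `χ = 10/9`);
* `meanValue_inequality_tenThirds` —
  `‖w(F)‖_{L^∞(Q(ρ/2))} ≤ C(C_B) ρ^{-3/2} ‖w(F)‖_{L^{10/3}(Q(ρ))}`.

## References

* Z. Lei, Q. S. Zhang, J. Funct. Anal. 261 (2011) = arXiv:1011.5066, §2, (2.5)–(2.6), p. 8
  (any `p₀ > 3`; the paper takes `3`). [LeiZhang2011]
-/

noncomputable section

open MeasureTheory Set Function Filter Metric intervalIntegral
open _root_.Topology
open scoped InnerProductSpace RealInnerProductSpace NNReal ENNReal Laplacian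

namespace Literature.Analysis.FluidPDE

namespace LeiZhang2011

open Literature.Analysis.FunctionSpaces

/-- **The Moser chain on parabolic cylinders from `L^{10/3}`** (Lei–Zhang 2011, (2.5)–(2.6)): reverse Hölder
inequalities between the consecutive cylinders `Q_k = (−r_k², 0] × B̄(0, r_k)`,
`r_k = (ρ/2)(1 + 3^{-k})`, with exponents `p_k = (10/3)(10/9)^k` and constants `(C₀ b^k)^{10/9}`,
imply the mean value bound `‖u‖_{L^∞(Q(ρ/2))} ≤ C₀^{3} b^{27} ‖u‖_{L^{10/3}(Q(ρ))}`. [cite: LeiZhang2011, §2 (2.5)–(2.6) (arXiv p. 8), the iteration] -/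
theorem eLpNorm_top_cylinder_le_of_reverse_holder_tenThirds {u : ℝ × EuclideanSpace ℝ (Fin 3) → ℝ}
    (hu : AEStronglyMeasurable u ((volume : Measure ℝ).prod (volume : Measure (EuclideanSpace ℝ (Fin 3)))))
    (hu0 : ∀ p, 0 ≤ u p) {ρ : ℝ} (hρ : 0 < ρ) {C₀ b : ℝ≥0} (hC₀ : C₀ ≠ 0) (hb : b ≠ 0)
    (H : ∀ k : ℕ,
      ∫⁻ p in Ioo (-(ρ / 2 * (1 + (1 / 3 : ℝ) ^ (k + 1))) ^ 2) 0 ×ˢ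
          ball (0 : EuclideanSpace ℝ (Fin 3)) (ρ / 2 * (1 + (1 / 3 : ℝ) ^ (k + 1))),
          ENNReal.ofReal (u p) ^ (10 / 3 * (10 / 9 : ℝ) ^ (k + 1)) ∂((volume : Measure ℝ).prod volume) ≤
        (((C₀ : ℝ≥0∞) * (b : ℝ≥0∞) ^ k) ^ (10 / 9 : ℝ)) *
          (∫⁻ p in Ioc (-(ρ / 2 * (1 + (1 / 3 : ℝ) ^ k)) ^ 2) 0 ×ˢ
              closedBall (0 : EuclideanSpace ℝ (Fin 3)) (ρ / 2 * (1 + (1 / 3 : ℝ) ^ k)),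
              ENNReal.ofReal (u p) ^ (10 / 3 * (10 / 9 : ℝ) ^ k) ∂((volume : Measure ℝ).prod volume)) ^ (10 / 9 : ℝ)) :
    eLpNorm u ∞ (((volume : Measure ℝ).prod (volume : Measure (EuclideanSpace ℝ (Fin 3)))).restrict
        (Ioc (-(ρ / 2) ^ 2) 0 ×ˢ closedBall (0 : EuclideanSpace ℝ (Fin 3)) (ρ / 2))) ≤
      (C₀ : ℝ≥0∞) ^ (3 : ℝ) * (b : ℝ≥0∞) ^ (27 : ℝ) *
        eLpNorm u (ENNReal.ofReal (10 / 3)) (((volume : Measure ℝ).prod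
          (volume : Measure (EuclideanSpace ℝ (Fin 3)))).restrict
            (Ioc (-ρ ^ 2) 0 ×ˢ closedBall (0 : EuclideanSpace ℝ (Fin 3)) ρ)) := by
  set μ : Measure (ℝ × EuclideanSpace ℝ (Fin 3)) := (volume : Measure ℝ).prod volume with hμ
  -- the radii and the cylinders
  obtain ⟨r, hr⟩ : ∃ r : ℕ → ℝ, ∀ k, r k = ρ / 2 * (1 + (1 / 3 : ℝ) ^ k) := ⟨_, fun _ => rfl⟩
  have hrb : ∀ k, 0 < r k ∧ ρ / 2 ≤ r k ∧ r k ≤ ρ := fun k => by rw [hr k]; exact moser_radius_bounds hρ k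
  set A : ℕ → Set (ℝ × EuclideanSpace ℝ (Fin 3)) := fun k =>
    Ioc (-(r k) ^ 2) 0 ×ˢ closedBall (0 : EuclideanSpace ℝ (Fin 3)) (r k) with hA
  -- the exponents
  have hp : ∀ k : ℕ, (0 : ℝ) < 10 / 3 * (10 / 9 : ℝ) ^ k := fun k => by positivity
  -- the interior cylinder of level `k+1` is a.e. equal to `A (k+1)`
  have hae : ∀ k, (Ioo (-(r (k + 1)) ^ 2) 0 ×ˢ ball (0 : EuclideanSpace ℝ (Fin 3)) (r (k + 1)) :
      Set (ℝ × EuclideanSpace ℝ (Fin 3))) =ᵐ[μ] A (k + 1) := fun k =>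
    Measure.set_prod_ae_eq (Ioo_ae_eq_Ioc (μ := (volume : Measure ℝ)))
      (JohnNirenberg.closedBall_ae_eq_ball (0 : EuclideanSpace ℝ (Fin 3)) (hrb (k + 1)).1).symm
  -- eLpNorm in terms of the lintegral
  have hnorm : ∀ (k : ℕ) (S : Set (ℝ × EuclideanSpace ℝ (Fin 3))),
      eLpNorm u (ENNReal.ofReal (10 / 3 * (10 / 9 : ℝ) ^ k)) (μ.restrict S) =
        (∫⁻ p in S, ENNReal.ofReal (u p) ^ (10 / 3 * (10 / 9 : ℝ) ^ k) ∂μ) ^ (1 / (10 / 3 * (10 / 9 : ℝ) ^ k)) := by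
    intro k S
    rw [eLpNorm_eq_lintegral_rpow_enorm_toReal (ENNReal.ofReal_pos.2 (hp k)).ne' ENNReal.ofReal_ne_top,
      ENNReal.toReal_ofReal (hp k).le]
    congr 1
    refine lintegral_congr fun p => ?_
    rw [Real.enorm_eq_ofReal (hu0 p)]
  -- the chain hypothesis in `eLpNorm` form
  have Hchain : ∀ k : ℕ, eLpNorm u (ENNReal.ofReal (10 / 3 * (10 / 9 : ℝ) ^ (k + 1))) (μ.restrict (A (k + 1))) ≤
      ((C₀ : ℝ≥0∞) * (b : ℝ≥0∞) ^ k) ^ (1 / (10 / 3 * (10 / 9 : ℝ) ^ k)) *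
        eLpNorm u (ENNReal.ofReal (10 / 3 * (10 / 9 : ℝ) ^ k)) (μ.restrict (A k)) := by
    intro k
    have h := H k
    simp only [← hr] at h
    rw [hnorm, hnorm, ← Measure.restrict_congr_set (hae k)]
    have hpk1 : 0 < 1 / (10 / 3 * (10 / 9 : ℝ) ^ (k + 1)) := by positivity
    calc (∫⁻ p in Ioo (-(r (k + 1)) ^ 2) 0 ×ˢ ball (0 : EuclideanSpace ℝ (Fin 3)) (r (k + 1)),
          ENNReal.ofReal (u p) ^ (10 / 3 * (10 / 9 : ℝ) ^ (k + 1)) ∂μ) ^ (1 / (10 / 3 * (10 / 9 : ℝ) ^ (k + 1)))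
        ≤ ((((C₀ : ℝ≥0∞) * (b : ℝ≥0∞) ^ k) ^ (10 / 9 : ℝ)) *
            (∫⁻ p in A k, ENNReal.ofReal (u p) ^ (10 / 3 * (10 / 9 : ℝ) ^ k) ∂μ) ^ (10 / 9 : ℝ)) ^
              (1 / (10 / 3 * (10 / 9 : ℝ) ^ (k + 1))) := ENNReal.rpow_le_rpow h hpk1.le
      _ = ((C₀ : ℝ≥0∞) * (b : ℝ≥0∞) ^ k) ^ (1 / (10 / 3 * (10 / 9 : ℝ) ^ k)) *
            (∫⁻ p in A k, ENNReal.ofReal (u p) ^ (10 / 3 * (10 / 9 : ℝ) ^ k) ∂μ) ^ (1 / (10 / 3 * (10 / 9 : ℝ) ^ k)) := by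
          rw [ENNReal.mul_rpow_of_nonneg _ _ hpk1.le, ← ENNReal.rpow_mul, ← ENNReal.rpow_mul]
          congr 2 <;> · rw [pow_succ]; field_simp
  -- the abstract Moser chain
  have hchain := eLpNorm_top_le_of_moser_chain (μ := μ) hu (A := A) (p₀ := 10 / 3) (χ := 10 / 9)
    (by norm_num) (by norm_num) hC₀ hb Hchain
  -- `⋂ A k ⊇ Q(ρ/2)`, `A 0 = Q(ρ)`
  have hA0 : A 0 = Ioc (-ρ ^ 2) 0 ×ˢ closedBall (0 : EuclideanSpace ℝ (Fin 3)) ρ := by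
    simp only [hA, hr, pow_zero]; norm_num
  have hsub : Ioc (-(ρ / 2) ^ 2) 0 ×ˢ closedBall (0 : EuclideanSpace ℝ (Fin 3)) (ρ / 2) ⊆ ⋂ k, A k := by
    refine subset_iInter fun k => prod_mono (Ioc_subset_Ioc ?_ le_rfl) (closedBall_subset_closedBall (hrb k).2.1)
    have := (hrb k).2.1
    nlinarith [hρ]
  calc eLpNorm u ∞ (μ.restrict (Ioc (-(ρ / 2) ^ 2) 0 ×ˢ closedBall (0 : EuclideanSpace ℝ (Fin 3)) (ρ / 2)))
      ≤ eLpNorm u ∞ (μ.restrict (⋂ k, A k)) := eLpNorm_mono_measure u (Measure.restrict_mono hsub le_rfl)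
    _ ≤ (C₀ : ℝ≥0∞) ^ ((10 / 9 : ℝ) / (10 / 3 * (10 / 9 - 1))) *
          (b : ℝ≥0∞) ^ ((10 / 9 : ℝ) / (10 / 3 * (10 / 9 - 1) ^ 2)) *
          eLpNorm u (ENNReal.ofReal (10 / 3)) (μ.restrict (A 0)) := hchain
    _ = (C₀ : ℝ≥0∞) ^ (3 : ℝ) * (b : ℝ≥0∞) ^ (27 : ℝ) *
          eLpNorm u (ENNReal.ofReal (10 / 3)) (μ.restrict (Ioc (-ρ ^ 2) 0 ×ˢ closedBall (0 : EuclideanSpace ℝ (Fin 3)) ρ)) := by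
        rw [hA0]; norm_num


/-- **The mean value inequality (Lei–Zhang 2011, (2.6)) for the swirl-type equation with a
`BMO` stream function, in `L^{10/3}`.** For every bound `C_B` of the `BMO` seminorm there is a constant
`C ≥ 0` such that: for every radius `ρ > 0`, every solution `F` in the setting at radius `ρ`
(hypotheses as in `reverse_holder_between_cylinders`), and every admissible power family
`H_m = w^m`, `m > 2` (`H_m ∈ C²`, `H_m(0) = 0`, `H_m'' ≥ 0`, `H_m'² ≤ (m/(m−1)) H_m H_m''`, with
`C¹` square roots `s_m`, `s_m² = H_m`, `2 s_m'² ≤ H_m''`), the quantity `u = w(F)` satisfies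
`‖u‖_{L^∞((−ρ²/4,0]×B̄(0,ρ/2))} ≤ C ρ^{-3/2} ‖u‖_{L^{10/3}((−ρ²,0]×B̄(0,ρ))}` — the variant of
`meanValue_inequality` (exponent `4`) started at the Leray–Hopf exponent `10/3`, as needed for
solutions of finite energy (any `p₀ > 3` is admissible, paper: `p₀ = 3`).
[cite: LeiZhang2011, §2 (2.6) (arXiv p. 8), the local maximum estimate] -/
theorem meanValue_inequality_tenThirds (CB : ℝ≥0) :
    ∃ Cmv : ℝ, 0 ≤ Cmv ∧ ∀ ⦃ρ : ℝ⦄, 0 < ρ →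
      ∀ ⦃F N : ℝ → EuclideanSpace ℝ (Fin 3) → ℝ⦄
        ⦃b Bst : ℝ → EuclideanSpace ℝ (Fin 3) → EuclideanSpace ℝ (Fin 3)⦄,
      (∀ s, ContDiff ℝ 2 (F s)) → (∀ s, IsAxisymmetricScalar (F s)) →
      (∀ s x, cylRadius x = 0 → F s x = 0) →
      (∀ s, LocallyIntegrable (b s) volume) →
      (∀ᵐ s ∂(volume.restrict (Ioc (-ρ ^ 2) 0)),
        Differentiable ℝ (Bst s) ∧ curl (Bst s) =ᵐ[volume] b s ∧ eBMOSeminormVec (Bst s) ≤ CB) →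
      (∀ s x, N s x =
        (Δ (F s)) x - fderiv ℝ (F s) x (b s x) - 2 / cylRadius x * fderiv ℝ (F s) x (eR x)) →
      (∀ᵐ x ∂(volume : Measure (EuclideanSpace ℝ (Fin 3))),
        IntervalIntegrable (fun s => N s x) volume (-ρ ^ 2) 0 ∧
          ∀ s ∈ Icc (-ρ ^ 2) 0, F s x = F (-ρ ^ 2) x + ∫ τ in (-ρ ^ 2)..s, N τ x) →
      (Continuous fun p : ℝ × EuclideanSpace ℝ (Fin 3) => F p.1 p.2) →
      (Continuous fun p : ℝ × EuclideanSpace ℝ (Fin 3) => gradient (F p.1) p.2) →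
      AEStronglyMeasurable (fun p : ℝ × EuclideanSpace ℝ (Fin 3) => N p.1 p.2)
        ((volume.restrict (Ioc (-ρ ^ 2) 0)).prod volume) →
      Integrable (fun p : ℝ × EuclideanSpace ℝ (Fin 3) => N p.1 p.2)
        ((volume.restrict (Ioc (-ρ ^ 2) 0)).prod (volume.restrict (closedBall 0 ρ))) →
      AEStronglyMeasurable (fun p : ℝ × EuclideanSpace ℝ (Fin 3) => b p.1 p.2)
        ((volume.restrict (Ioc (-ρ ^ 2) 0)).prod volume) →
      ∀ ⦃Mb : ℝ⦄, (∀ s, ∀ x ∈ closedBall (0 : EuclideanSpace ℝ (Fin 3)) ρ, ‖b s x‖ ≤ Mb) →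
      ∀ ⦃w : ℝ → ℝ⦄, (∀ v, 0 ≤ w v) → Continuous w →
      ∀ ⦃Hf sf : ℝ → ℝ → ℝ⦄, (∀ m v, 2 < m → Hf m v = w v ^ m) →
      (∀ m, 2 < m → ContDiff ℝ 2 (Hf m) ∧ Hf m 0 = 0 ∧ (∀ v, 0 ≤ deriv (deriv (Hf m)) v) ∧
        (∀ v, deriv (Hf m) v ^ 2 ≤ m / (m - 1) * (Hf m v * deriv (deriv (Hf m)) v)) ∧
        ContDiff ℝ 1 (sf m) ∧ (∀ v, sf m v ^ 2 = Hf m v) ∧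
        (∀ v, 2 * deriv (sf m) v ^ 2 ≤ deriv (deriv (Hf m)) v)) →
      eLpNorm (fun p : ℝ × EuclideanSpace ℝ (Fin 3) => w (F p.1 p.2)) ∞
          (((volume : Measure ℝ).prod (volume : Measure (EuclideanSpace ℝ (Fin 3)))).restrict
            (Ioc (-(ρ / 2) ^ 2) 0 ×ˢ closedBall (0 : EuclideanSpace ℝ (Fin 3)) (ρ / 2))) ≤
        ENNReal.ofReal (Cmv * ρ ^ (-(3 / 2 : ℝ))) *
          eLpNorm (fun p : ℝ × EuclideanSpace ℝ (Fin 3) => w (F p.1 p.2)) (ENNReal.ofReal (10 / 3))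
            (((volume : Measure ℝ).prod (volume : Measure (EuclideanSpace ℝ (Fin 3)))).restrict
              (Ioc (-ρ ^ 2) 0 ×ˢ closedBall (0 : EuclideanSpace ℝ (Fin 3)) ρ)) := by
  -- the absolute constants
  obtain ⟨Cφ, hCφ0, hCφ⟩ := exists_norm_gradient_radialCutoff_le
  obtain ⟨CT, hCT0, hCT⟩ := exists_abs_deriv_smoothTransition_le
  obtain ⟨CJ, hCJ0, hCJ⟩ := exists_setIntegral_norm_sub_sq_cube_le
  set CS : ℝ := (SNormLESNormFDerivOfEqConst ℝ (volume : Measure (EuclideanSpace ℝ (Fin 3))) 2 : ℝ) with hCS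
  set V₁ : ℝ := volume.real (ball (0 : EuclideanSpace ℝ (Fin 3)) 1) with hV₁
  have hV₁0 : 0 ≤ V₁ := measureReal_nonneg
  set c₁ : ℝ := (5 / 2) * CS ^ 2 * V₁ ^ (5 / 9 : ℝ) * (8 * Cφ ^ 2 + CT + 8 * Cφ ^ 2 * CJ * (CB : ℝ) ^ 2) ^ (5 / 3 : ℝ) *
    (9 : ℝ) ^ (5 / 3 : ℝ) with hc₁
  have hc₁0 : 0 ≤ c₁ := by positivity
  set c₁' : ℝ := c₁ + 1 with hc₁'
  have hc₁'0 : 0 < c₁' := by positivity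
  refine ⟨c₁' ^ (27 / 10 : ℝ) * (27 : ℝ) ^ (27 : ℝ), by positivity, ?_⟩
  intro ρ hρ F N b Bst hF2 hFa hF0 hb hBst hN heq hFc hF1c hNm hNi hbm Mb hbB w hw0 hwc Hf sf hHw hfam
  -- the chain constants
  set C₀r : ℝ := (c₁' * ρ ^ (-(5 / 9 : ℝ))) ^ (9 / 10 : ℝ) with hC₀r
  have hC₀r0 : 0 < C₀r := by positivity
  set C₀ : ℝ≥0 := Real.toNNReal C₀r with hC₀
  have hC₀ne : C₀ ≠ 0 := fun h => (not_le.2 hC₀r0) (Real.toNNReal_eq_zero.1 h)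
  have hC₀e : ((C₀ : ℝ≥0∞)) = ENNReal.ofReal C₀r := rfl
  have hu : AEStronglyMeasurable (fun p : ℝ × EuclideanSpace ℝ (Fin 3) => w (F p.1 p.2))
      ((volume : Measure ℝ).prod (volume : Measure (EuclideanSpace ℝ (Fin 3)))) :=
    (hwc.comp hFc).aestronglyMeasurable
  have hchain := eLpNorm_top_cylinder_le_of_reverse_holder_tenThirds hu (fun p => hw0 _) hρ hC₀ne
    (b := 27) (by norm_num) ?_
  · refine hchain.trans (le_of_eq ?_)
    congr 1
    -- `C₀^{3} 27^{27} = ofReal (c₁'^{27/10} 27^{27} ρ^{-3/2})`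
    rw [hC₀e, ENNReal.ofReal_rpow_of_nonneg hC₀r0.le (by norm_num),
      show ((27 : ℝ≥0) : ℝ≥0∞) = ENNReal.ofReal 27 by norm_num,
      ENNReal.ofReal_rpow_of_nonneg (by norm_num) (by norm_num), ← ENNReal.ofReal_mul (by positivity)]
    congr 1
    rw [hC₀r, ← Real.rpow_mul (by positivity), Real.mul_rpow hc₁'0.le (Real.rpow_nonneg hρ.le _),
      ← Real.rpow_mul hρ.le]
    norm_num
    ring
  -- ### the reverse Hölder inequality at level `k`
  intro k
  obtain ⟨hrk0, hrklo, hrkhi⟩ := moser_radius_bounds hρ k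
  obtain ⟨hrk10, hrk1lo, hrk1hi⟩ := moser_radius_bounds hρ (k + 1)
  set r₁ : ℝ := ρ / 2 * (1 + (1 / 3 : ℝ) ^ k) with hr₁
  set r₂ : ℝ := ρ / 2 * (1 + (1 / 3 : ℝ) ^ (k + 1)) with hr₂
  have hr : r₂ < r₁ := by
    rw [hr₁, hr₂, pow_succ]
    have : 0 < (1 / 3 : ℝ) ^ k := by positivity
    nlinarith
  -- the exponent `m = (20/9)(10/9)^k > 2`
  set m : ℝ := 20 / 9 * (10 / 9 : ℝ) ^ k with hm
  have hmk : (1 : ℝ) ≤ (10 / 9 : ℝ) ^ k := one_le_pow₀ (by norm_num)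
  have hm2 : 2 < m := by rw [hm]; nlinarith
  obtain ⟨hH, hH00, hH2, hκ', hsH, hsH2, hsH'⟩ := hfam m hm2
  have hH0 : ∀ v, 0 ≤ Hf m v := fun v => by rw [hHw m v hm2]; exact Real.rpow_nonneg (hw0 v) _
  set κ : ℝ := m / (m - 1) with hκdef
  have hm1 : 0 < m - 1 := by linarith
  have hκ1 : 1 ≤ κ := by rw [hκdef, le_div_iff₀ hm1]; linarith
  have hκ2 : κ ≤ 2 := by rw [hκdef, div_le_iff₀ hm1]; linarith
  have hκ : ∀ v, deriv (Hf m) v ^ 2 ≤ κ * Hf m v * deriv (deriv (Hf m)) v := fun v => by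
    rw [mul_assoc]; exact hκ' v
  have hlev := reverse_holder_between_cylinders (ρ := ρ) (CB := CB) hF2 hFa hF0 hb hBst hN heq hFc hF1c
    hNm hNi hbm hbB hH hH00 hH0 hH2 hκ1 hκ hsH hsH2 hsH' hCφ hCT hCJ0 hCJ hrk10 hr hrkhi
  -- rewrite the integrands as powers of `u = w(F)`
  have hexp1 : ∀ p : ℝ × EuclideanSpace ℝ (Fin 3),
      ENNReal.ofReal (Hf m (F p.1 p.2)) ^ (5 / 3 : ℝ) =
        ENNReal.ofReal (w (F p.1 p.2)) ^ (10 / 3 * (10 / 9 : ℝ) ^ (k + 1)) := by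
    intro p
    rw [hHw m _ hm2, ← ENNReal.ofReal_rpow_of_nonneg (hw0 _) (by rw [hm]; positivity),
      ← ENNReal.rpow_mul, hm, pow_succ]
    congr 1; ring
  have hexp2 : ∀ p : ℝ × EuclideanSpace ℝ (Fin 3),
      ENNReal.ofReal (Hf m (F p.1 p.2)) ^ (3 / 2 : ℝ) =
        ENNReal.ofReal (w (F p.1 p.2)) ^ (10 / 3 * (10 / 9 : ℝ) ^ k) := by
    intro p
    rw [hHw m _ hm2, ← ENNReal.ofReal_rpow_of_nonneg (hw0 _) (by rw [hm]; positivity),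
      ← ENNReal.rpow_mul, hm]
    congr 1; ring
  simp_rw [hexp1, hexp2] at hlev
  refine hlev.trans (mul_le_mul' ?_ le_rfl)
  -- ### the constant: `K_k ≤ (C₀ 27^k)^{10/9}`
  obtain ⟨hVc0, hVc, hVb0, hVb⟩ := volumeReal_ball_le hrk0 hrkhi
  have harith := moser_level_constant_le k hρ (CS := CS) (Cφ := Cφ) (CB := (CB : ℝ)) hCT0 hCJ0 hV₁0
    (zero_le_one.trans hκ1) hκ2 hVc0 hVc hVb0 hVb hr₁ hr₂
  have hrhs : (((C₀ : ℝ≥0∞) * ((27 : ℝ≥0) : ℝ≥0∞) ^ k) ^ (10 / 9 : ℝ)) =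
      ENNReal.ofReal (c₁' * ρ ^ (-(5 / 9 : ℝ)) * (27 : ℝ) ^ ((10 / 9 : ℝ) * k)) := by
    have h27k : ((27 : ℝ≥0) : ℝ≥0∞) ^ k = ENNReal.ofReal ((27 : ℝ) ^ k) := by
      rw [ENNReal.ofReal_pow (by norm_num)]; norm_num
    have key : (C₀r * (27 : ℝ) ^ k) ^ (10 / 9 : ℝ) = c₁' * ρ ^ (-(5 / 9 : ℝ)) * (27 : ℝ) ^ ((10 / 9 : ℝ) * k) := by
      rw [Real.mul_rpow hC₀r0.le (by positivity), hC₀r, ← Real.rpow_mul (by positivity),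
        ← Real.rpow_natCast (27 : ℝ) k, ← Real.rpow_mul (by norm_num),
        show (9 / 10 : ℝ) * (10 / 9) = 1 by norm_num, Real.rpow_one, mul_comm (k : ℝ)]
    rw [hC₀e, h27k, ← ENNReal.ofReal_mul hC₀r0.le,
      ENNReal.ofReal_rpow_of_nonneg (by positivity) (by norm_num), key]
  rw [hrhs]
  refine ENNReal.ofReal_le_ofReal (harith.trans ?_)
  have h27 : 0 ≤ ρ ^ (-(5 / 9 : ℝ)) * (27 : ℝ) ^ ((10 / 9 : ℝ) * k) := by positivity
  calc c₁ * ρ ^ (-(5 / 9 : ℝ)) * (27 : ℝ) ^ ((10 / 9 : ℝ) * k)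
      = c₁ * (ρ ^ (-(5 / 9 : ℝ)) * (27 : ℝ) ^ ((10 / 9 : ℝ) * k)) := by ring
    _ ≤ c₁' * (ρ ^ (-(5 / 9 : ℝ)) * (27 : ℝ) ^ ((10 / 9 : ℝ) * k)) :=
        mul_le_mul_of_nonneg_right (by linarith) h27
    _ = c₁' * ρ ^ (-(5 / 9 : ℝ)) * (27 : ℝ) ^ ((10 / 9 : ℝ) * k) := by ring


end LeiZhang2011

end Literature.Analysis.FluidPDE
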